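import Mathlib
import Literature.Computability.AlgebraicComplexity.StandardFamilies
import Summits.ValiantsHypothesis.ValiantsHypothesis.Theorems.ValuativeGCTValuativeFlipPencilEvalCheck

/-!
# Evaluation certificates for the four-row pencil rank, III: a pruned DP and a restricted member set
# (≈ 3× faster certificates, so that inner size `N = 11` fits the gate's elaboration budget)

Helper file (`--supports stmt-ValiantsHypothesis-12624`) for crux `ValuativeGCT.ValuativeFlip`, line
`four-row-count`, wall-breaker axis k14 "small cases certified"; sequel of
`…PencilEvalCertificate.lean` / `…PencilEvalCheck.lean`.  The certificate `pencilCheck 10 380 364` (inner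
size `11`, rank `364 = C(14,3)`) is `true` but takes ≈ 20 min in the interpreter, twice the gate's budget.
Two purely computational savings, each proved to agree with the landed spec `valP`:

* `PTblZ` — subset tables with an explicit ALL-ZERO subtree constructor `znode` (structural pruning: the
  start table, scalar multiples and Laplace rows preserve `znode`), and a FUSED row operation `axpy`
  (`x·s + u` in one traversal); `PTblZ.castZ_dpFZ`: read through `Nat.cast : ℕ → ZMod p` the pruned DP
  `dpFZ` IS the landed `PTbl.dpF` (via `PTbl.add`/`smul`/`step` of zero tables);
* `valTableK` — the value table restricted to the members `(t, (k, l))` with deleted row `k < K` (only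
  `K` DP trees per point instead of `n + 1`), `valTableK_get`: its entries cast to `valP` at the
  corresponding FULL member (`toFullMember`); the landed solver `solveCert`, `NinvN` and `mulCheckN_sound`
  apply verbatim;
* `pencilCheckK n K P r` and **`le_finrank_of_pencilCheckK`**: the same conclusion as
  `le_finrank_of_pencilCheck` (rank `≥ r` of the FULL four-row pencil family of `pencilZ n`), through
  `le_finrank_of_valP_mul_eq_one` (the tail of the landed soundness chain, isolated for arbitrary
  selections of points and members).
[folklore; this crux's …PencilEvalCheck.lean]
-/

set_option linter.dupNamespace false

namespace Summit.ValiantsHypothesis.ValiantsHypothesis.Theorems.ValuativeFlip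

open MvPolynomial
open scoped BigOperators Matrix
open Literature.Computability.AlgebraicComplexity

/-! ## Zero tables under the landed operations -/

namespace PTbl

/-- `0 + t = t` for tables. [folklore] -/
theorem zero_add' {R : Type*} [CommSemiring R] : ∀ {d : ℕ} (t : PTbl R d), add (zero d) t = t
  | 0, leaf v => by simp only [zero, add, zero_add]
  | _ + 1, node a b => by simp only [zero, add, zero_add' a, zero_add' b]

/-- `t + 0 = t` for tables. [folklore] -/
theorem add_zero' {R : Type*} [CommSemiring R] : ∀ {d : ℕ} (t : PTbl R d), add t (zero d) = t
  | 0, leaf v => by simp only [zero, add, add_zero]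
  | _ + 1, node a b => by simp only [zero, add, add_zero' a, add_zero' b]

/-- `x · 0 = 0` for tables. [folklore] -/
theorem smul_zero' {R : Type*} [CommSemiring R] (x : R) : ∀ (d : ℕ), smul x (zero d) = (zero d : PTbl R d)
  | 0 => by simp only [zero, smul, mul_zero]
  | d + 1 => by simp only [zero, smul, smul_zero' x d]

/-- A Laplace row of the zero table is zero. [folklore] -/
theorem step_zero' {R : Type*} [CommSemiring R] : ∀ (d : ℕ) (a : Fin d → R),
    step a (zero d) = (zero d : PTbl R d)
  | 0, a => by simp only [zero, step]
  | d + 1, a => by simp only [zero, step, step_zero' d, smul_zero', add_zero']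

end PTbl

/-! ## Pruned subset tables on `ℕ` -/

/-- Subset tables on `ℕ` with an explicit all-zero subtree `znode` (pruning). [folklore] -/
inductive PTblZ : ℕ → Type
  /-- depth `0`: the value at `∅` -/
  | leaf : ℕ → PTblZ 0
  /-- an all-zero table of any depth -/
  | znode {d : ℕ} : PTblZ d
  /-- depth `d + 1`: (subsets without `0`, subsets with `0`) -/
  | node {d : ℕ} : PTblZ d → PTblZ d → PTblZ (d + 1)

namespace PTblZ

/-- Expansion to a landed table (semantics only; never executed). [folklore] -/
def toP : {d : ℕ} → PTblZ d → PTbl ℕ d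
  | _, znode => PTbl.zero _
  | 0, leaf v => PTbl.leaf v
  | _ + 1, node a b => PTbl.node (toP a) (toP b)

/-- The table over `ZMod p` that a pruned table stands for. [folklore] -/
def castZ (p : ℕ) {d : ℕ} (t : PTblZ d) : PTbl (ZMod p) d := PTbl.map (Nat.cast : ℕ → ZMod p) (toP t)

/-- Lookup (zero on `znode`). [folklore] -/
def getZ : {d : ℕ} → PTblZ d → (Fin d → Bool) → ℕ
  | _, znode, _ => 0
  | 0, leaf v, _ => v
  | _ + 1, node t0 t1, f => if f 0 = true then getZ t1 (Fin.tail f) else getZ t0 (Fin.tail f)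

/-- The start table `[S = ∅]`, pruned. [folklore] -/
def initZ : (d : ℕ) → PTblZ d
  | 0 => leaf 1
  | d + 1 => node (initZ d) znode

/-- Scalar multiple modulo `p`, pruned. [folklore] -/
def smulZ (p x : ℕ) : {d : ℕ} → PTblZ d → PTblZ d
  | _, znode => znode
  | 0, leaf v => leaf (x * v % p)
  | _ + 1, node a b => node (smulZ p x a) (smulZ p x b)

/-- FUSED `x · s + u` modulo `p`, pruned (one traversal). [folklore] -/
def axpy (p x : ℕ) : {d : ℕ} → PTblZ d → PTblZ d → PTblZ d
  | _, znode, u => u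
  | 0, leaf v, znode => leaf (x * v % p)
  | 0, leaf v, leaf w => leaf ((x * v + w) % p)
  | _ + 1, node a b, znode => node (smulZ p x a) (smulZ p x b)
  | _ + 1, node a b, node c e => node (axpy p x a c) (axpy p x b e)

/-- One Laplace row modulo `p`, pruned and fused. [folklore] -/
def stepZ (p : ℕ) : {d : ℕ} → (Fin d → ℕ) → PTblZ d → PTblZ d
  | _, _, znode => znode
  | 0, _, leaf _ => znode
  | _ + 1, a, node t0 t1 => node (stepZ p (Fin.tail a) t0) (axpy p (a 0) t0 (stepZ p (Fin.tail a) t1))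

/-- The permanent DP modulo `p`, pruned. [folklore] -/
def dpFZ (p : ℕ) {d : ℕ} : (L : ℕ) → (Fin L → Fin d → ℕ) → PTblZ d
  | 0, _ => initZ d
  | L + 1, rows => stepZ p (rows 0) (dpFZ p L (Fin.tail rows))

section Agreement

variable (p : ℕ)

/-- `znode` stands for the zero table. [folklore] -/
@[simp] theorem castZ_znode (d : ℕ) : castZ p (znode : PTblZ d) = PTbl.zero d := by
  cases d <;> simp only [castZ, toP, PTbl.map_zero_natCast]

/-- A leaf stands for the cast leaf. [folklore] -/
@[simp] theorem castZ_leaf (v : ℕ) : castZ p (leaf v) = PTbl.leaf (v : ZMod p) := rfl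

/-- A node stands for the node of what its children stand for. [folklore] -/
@[simp] theorem castZ_node {d : ℕ} (a b : PTblZ d) :
    castZ p (node a b) = PTbl.node (castZ p a) (castZ p b) := rfl

/-- Lookup through the cast. [folklore] -/
theorem cast_getZ : ∀ {d : ℕ} (t : PTblZ d) (f : Fin d → Bool),
    ((getZ t f : ℕ) : ZMod p) = PTbl.get (castZ p t) f
  | d, znode, f => by rw [getZ, castZ_znode, PTbl.get_zero, Nat.cast_zero]
  | 0, leaf v, f => by simp only [getZ, castZ_leaf, PTbl.get_leaf]
  | _ + 1, node t0 t1, f => by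
      simp only [getZ, castZ_node, PTbl.get_node, ← cast_getZ t0, ← cast_getZ t1]
      split <;> rfl

/-- The pruned start table is the start table. [folklore] -/
theorem castZ_initZ : ∀ d : ℕ, castZ p (initZ d) = PTbl.init d
  | 0 => by simp only [initZ, castZ_leaf, Nat.cast_one, PTbl.init]
  | d + 1 => by simp only [initZ, castZ_node, castZ_initZ d, castZ_znode, PTbl.init]

/-- `smulZ` is `smul`. [folklore] -/
theorem castZ_smulZ (x : ℕ) : ∀ {d : ℕ} (t : PTblZ d),
    castZ p (smulZ p x t) = PTbl.smul (x : ZMod p) (castZ p t)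
  | d, znode => by rw [smulZ, castZ_znode, PTbl.smul_zero']
  | 0, leaf v => by simp only [smulZ, castZ_leaf, PTbl.smul, ZMod.natCast_mod, Nat.cast_mul]
  | _ + 1, node a b => by simp only [smulZ, castZ_node, castZ_smulZ x a, castZ_smulZ x b, PTbl.smul]

/-- `axpy` is `add (smul x ·) ·`. [folklore] -/
theorem castZ_axpy (x : ℕ) : ∀ {d : ℕ} (s u : PTblZ d),
    castZ p (axpy p x s u) = PTbl.add (PTbl.smul (x : ZMod p) (castZ p s)) (castZ p u)
  | d, znode, u => by rw [axpy, castZ_znode, PTbl.smul_zero', PTbl.zero_add']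
  | 0, leaf v, znode => by
      simp only [axpy, castZ_leaf, castZ_znode, PTbl.zero, PTbl.smul, PTbl.add, ZMod.natCast_mod,
        Nat.cast_mul, add_zero]
  | 0, leaf v, leaf w => by
      simp only [axpy, castZ_leaf, PTbl.smul, PTbl.add, ZMod.natCast_mod, Nat.cast_add, Nat.cast_mul]
  | _ + 1, node a b, znode => by
      rw [axpy, castZ_znode, PTbl.add_zero', castZ_node, castZ_node, castZ_smulZ, castZ_smulZ, PTbl.smul]
  | _ + 1, node a b, node c e => by
      simp only [axpy, castZ_node, castZ_axpy x a c, castZ_axpy x b e, PTbl.smul, PTbl.add]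

/-- `stepZ` is `step`. [folklore] -/
theorem castZ_stepZ : ∀ {d : ℕ} (a : Fin d → ℕ) (t : PTblZ d),
    castZ p (stepZ p a t) = PTbl.step (fun i => (a i : ZMod p)) (castZ p t)
  | d, a, znode => by rw [stepZ, castZ_znode, PTbl.step_zero']
  | 0, a, leaf v => by
      rw [stepZ, castZ_znode, castZ_leaf]
      rfl
  | _ + 1, a, node t0 t1 => by
      simp only [stepZ, castZ_node, castZ_axpy, castZ_stepZ (Fin.tail a), PTbl.step]
      rfl

/-- **The pruned DP is the landed DP** (read through `Nat.cast : ℕ → ZMod p`). [folklore] -/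
theorem castZ_dpFZ {d : ℕ} : ∀ (L : ℕ) (rows : Fin L → Fin d → ℕ),
    castZ p (dpFZ p L rows) = PTbl.dpF L (fun x i => (rows x i : ZMod p))
  | 0, rows => by simp only [dpFZ, PTbl.dpF, castZ_initZ]
  | L + 1, rows => by
      simp only [dpFZ, PTbl.dpF, castZ_stepZ, castZ_dpFZ L (Fin.tail rows)]
      rfl

end Agreement

end PTblZ

/-- The pruned `ℕ`-DP read modulo `certP` is the `ZMod certP`-DP. [folklore] -/
theorem natCast_getZ_dpFZ {L d : ℕ} (rows : Fin L → Fin d → ℕ) (f : Fin d → Bool) :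
    ((PTblZ.getZ (PTblZ.dpFZ certP L rows) f : ℕ) : ZMod certP) =
      PTbl.get (PTbl.dpF L (fun x i => (rows x i : ZMod certP))) f := by
  rw [PTblZ.cast_getZ, PTblZ.castZ_dpFZ]

/-! ## The value table restricted to deleted rows `k < K` -/

/-- Restricted member codes: `Fin 4 × (Fin K × Fin (n+1)) ≃ Fin (4 · K · (n+1))`. [folklore] -/
def memberEquivK (n K : ℕ) : Fin 4 × (Fin K × Fin (n + 1)) ≃ Fin (4 * (K * (n + 1))) :=
  (Equiv.prodCongr (Equiv.refl (Fin 4)) finProdFinEquiv).trans finProdFinEquiv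

/-- The full member of a restricted member: deleted row `k < K ≤ n + 1` read in `Fin (n + 1)`. [folklore] -/
def toFullMember (n K : ℕ) (hK : K ≤ n + 1) (tc : Fin 4 × (Fin K × Fin (n + 1))) :
    Fin 4 × (Fin (n + 1) × Fin (n + 1)) :=
  (tc.1, (Fin.castLE hK tc.2.1, tc.2.2))

/-- FAST restricted value table: `(valTableK n K hK P)[b][μ]` = value modulo `certP` of the restricted
member `μ` at the point `pointZ b`, `K` pruned DP trees per point. [folklore] -/
def valTableK (n K : ℕ) (hK : K ≤ n + 1) (P : ℕ) : Array (Array ℕ) :=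
  Array.ofFn fun b : Fin P =>
    let y : Fin 4 → ℤ := fun t => pointZ b t
    let yN : Fin 4 → ℕ := fun t => ((y t) % (certP : ℤ)).toNat
    let A : Matrix (Fin (n + 1)) (Fin (n + 1)) ℕ := matOfArr (n + 1) (n + 1) (arrOfMat (pencilMatN n y))
    let trees : Array (PTblZ (n + 1)) :=
      Array.ofFn fun k : Fin K => PTblZ.dpFZ certP n (fun x : Fin n => A ((Fin.castLE hK k).succAbove x))
    Array.ofFn fun μ : Fin (4 * (K * (n + 1))) =>
      yN ((memberEquivK n K).symm μ).1 *
        PTblZ.getZ (trees[((((memberEquivK n K).symm μ).2.1 : Fin K) : ℕ)]'(by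
            simp only [trees, Array.size_ofFn]; exact (((memberEquivK n K).symm μ).2.1).2))
          (fun i => decide (i ≠ ((memberEquivK n K).symm μ).2.2)) % certP

/-- Size of the restricted value table. [folklore] -/
theorem size_valTableK (n K : ℕ) (hK : K ≤ n + 1) (P : ℕ) : (valTableK n K hK P).size = P := by
  simp only [valTableK, Array.size_ofFn]

/-- Size of a column of the restricted value table. [folklore] -/
theorem size_valTableK_get (n K : ℕ) (hK : K ≤ n + 1) (P : ℕ) (b : ℕ)
    (hb : b < (valTableK n K hK P).size) : ((valTableK n K hK P)[b]).size = 4 * (K * (n + 1)) := by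
  simp only [valTableK, Array.getElem_ofFn, Array.size_ofFn]

/-- **The restricted fast table is the spec at the full member**:
`((valTableK …)[b][μ] : ZMod certP) = valP n (pointZ b) (toFullMember (member μ))`. [folklore] -/
theorem valTableK_get (n K : ℕ) (hK : K ≤ n + 1) (P : ℕ) (b : ℕ) (hb : b < (valTableK n K hK P).size)
    (μ : ℕ) (hμ : μ < ((valTableK n K hK P)[b]).size) :
    ((((valTableK n K hK P)[b])[μ] : ℕ) : ZMod certP) = valP n (fun t => pointZ b t)
      (toFullMember n K hK ((memberEquivK n K).symm ⟨μ, by rwa [size_valTableK_get] at hμ⟩)) := by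
  simp only [valTableK, Array.getElem_ofFn, matOfArr_arrOfMat, valP, toFullMember, ZMod.natCast_mod,
    Nat.cast_mul, natCast_toNat_emod, natCast_getZ_dpFZ, natCast_pencilMatN, PTbl.ind_univ_erase]

/-! ## The restricted check and its soundness -/

/-- The solver's restricted member code of column `b`, clamped into range (any value is sound). [folklore] -/
def selCodeK (n K : ℕ) (hK0 : 0 < K) (sol : Array ℕ × Array ℕ × Array (Array ℕ)) (b : ℕ) :
    Fin (4 * (K * (n + 1))) :=
  ⟨sol.1.getD b 0 % (4 * (K * (n + 1))), Nat.mod_lt _ (by positivity)⟩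

/-- FAST restricted certificate matrix on `ℕ`: a trivial accessor reading the restricted value table at
the solver's selections. [folklore] -/
def EfastK (n K P r : ℕ) (hK0 : 0 < K) [NeZero P] (tbl : Array (Array ℕ))
    (sol : Array ℕ × Array ℕ × Array (Array ℕ)) : Matrix (Fin r) (Fin r) ℕ :=
  Matrix.of fun a b => (tbl.getD (selPoint P sol a) #[]).getD ((selCodeK n K hK0 sol b : Fin _) : ℕ) 0

/-- `EfastK (valTableK …)` casts to `valP` at the selected point and the FULL member of the selected
restricted member. [folklore] -/
theorem natCast_EfastK_apply (n K P r : ℕ) (hK : K ≤ n + 1) (hK0 : 0 < K) [NeZero P]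
    (sol : Array ℕ × Array ℕ × Array (Array ℕ)) (a b : Fin r) :
    ((EfastK n K P r hK0 (valTableK n K hK P) sol a b : ℕ) : ZMod certP) =
      valP n (fun t => pointZ (selPoint P sol a) t)
        (toFullMember n K hK ((memberEquivK n K).symm (selCodeK n K hK0 sol b))) := by
  have h1 : selPoint P sol a < (valTableK n K hK P).size := by
    rw [size_valTableK]; exact selPoint_lt P sol a
  have h2 : ((selCodeK n K hK0 sol b : Fin _) : ℕ) < ((valTableK n K hK P)[selPoint P sol a]).size := by
    rw [size_valTableK_get]; exact (selCodeK n K hK0 sol b).2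
  have h3 : EfastK n K P r hK0 (valTableK n K hK P) sol a b =
      ((valTableK n K hK P)[selPoint P sol a])[((selCodeK n K hK0 sol b : Fin _) : ℕ)] := by
    unfold EfastK
    rw [Matrix.of_apply, array_getD_of_lt _ _ _ h1, array_getD_of_lt _ _ _ h2]
  rw [h3, valTableK_get]

/-- **The restricted trusted check** (`native_decide` in the instances files): restricted value table
once, untrusted solver, `E · N = 1 (mod certP)` by `mulCheckN`. [folklore] -/
def pencilCheckK (n K P r : ℕ) (hK : K ≤ n + 1) (hK0 : 0 < K) [NeZero P] : Bool :=
  let tbl := valTableK n K hK P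
  let sol := solveCert tbl (4 * (K * (n + 1))) P r
  mulCheckN r (EfastK n K P r hK0 tbl sol) (NinvN r sol)

/-- **The tail of the soundness chain, isolated**: if for SOME points `pt a` and SOME members `mem b` the
`r × r` matrix of modular values `valP` has a right inverse over `ZMod certP`, then the full four-row
pencil family of `pencilZ n` spans at least `r` dimensions (`valP_eq_cast`,
`prc_det_intCast_ne_zero_of_det_zmod_ne_zero`, `aeval_member_eq_cast`,
`prc_linearIndependent_of_det_ne_zero`, `prc_card_le_finrank_span_of_linearIndependent_comp`).
[folklore; this crux's …PencilEvalCheck.lean (`le_finrank_of_pencilCheck`)] -/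
theorem le_finrank_of_valP_mul_eq_one (n r : ℕ) (pt : Fin r → ℕ)
    (mem : Fin r → Fin 4 × (Fin (n + 1) × Fin (n + 1))) (N : Matrix (Fin r) (Fin r) (ZMod certP))
    (hEN : (Matrix.of fun a b : Fin r => valP n (fun t => pointZ (pt a) t) (mem b)) * N = 1) :
    r ≤ Module.finrank ℂ ↥(Submodule.span ℂ (Set.range fun tc : Fin 4 × (Fin (n + 1) × Fin (n + 1)) =>
      (X tc.1 : MvPolynomial (Fin 4) ℂ) *
        aeval (fun ij : Fin (n + 1) × Fin (n + 1) =>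
          ∑ t : Fin 4, (fun ij t => ((pencilZ n ij t : ℤ) : ℂ)) ij t • (X t : MvPolynomial (Fin 4) ℂ))
          (pderiv tc.2 (perPoly (Fin (n + 1)) ℂ)))) := by
  classical
  have hdetP : (Matrix.of fun a b : Fin r => valP n (fun t => pointZ (pt a) t) (mem b)).det ≠ 0 := by
    intro h0
    have h2 := congrArg Matrix.det hEN
    rw [Matrix.det_mul, h0, zero_mul, Matrix.det_one] at h2
    exact zero_ne_one h2
  set EZ : Matrix (Fin r) (Fin r) ℤ :=
    Matrix.of fun a b => memberValZ n (fun t => pointZ (pt a) t) (mem b) with hEZ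
  have hEZP : EZ.map (Int.castRingHom (ZMod certP)) =
      Matrix.of fun a b : Fin r => valP n (fun t => pointZ (pt a) t) (mem b) := by
    ext a b
    simp only [EZ, Matrix.map_apply, Matrix.of_apply, valP_eq_cast]
  have hdetC : (EZ.map (Int.castRingHom ℂ)).det ≠ 0 :=
    prc_det_intCast_ne_zero_of_det_zmod_ne_zero certP EZ (by rw [hEZP]; exact hdetP) ℂ
  set F : Fin 4 × (Fin (n + 1) × Fin (n + 1)) → MvPolynomial (Fin 4) ℂ := fun tc =>
    (X tc.1 : MvPolynomial (Fin 4) ℂ) *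
      aeval (fun ij : Fin (n + 1) × Fin (n + 1) =>
        ∑ t : Fin 4, (fun ij t => ((pencilZ n ij t : ℤ) : ℂ)) ij t • (X t : MvPolynomial (Fin 4) ℂ))
        (pderiv tc.2 (perPoly (Fin (n + 1)) ℂ)) with hF
  let φ : Fin r → MvPolynomial (Fin 4) ℂ →ₗ[ℂ] ℂ := fun a =>
    (MvPolynomial.aeval fun s : Fin 4 => ((pointZ (pt a) s : ℤ) : ℂ)).toLinearMap
  have hmat : (Matrix.of fun a b : Fin r => φ a (F (mem b))) = EZ.map (Int.castRingHom ℂ) := by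
    ext a b
    simp only [Matrix.of_apply, Matrix.map_apply, EZ, φ, F, AlgHom.toLinearMap_apply, eq_intCast]
    exact aeval_member_eq_cast n _ _
  have hli : LinearIndependent ℂ (F ∘ mem) := by
    refine prc_linearIndependent_of_det_ne_zero _ φ ?_
    simp only [Function.comp]
    rw [hmat]
    exact hdetC
  have hle := prc_card_le_finrank_span_of_linearIndependent_comp F mem hli
  simpa only [Fintype.card_fin] using hle

/-- **Soundness of the restricted certificate**: `pencilCheckK n K P r = true` gives `r ≤ finrank` of the
FULL four-row pencil family of `pencilZ n` (same conclusion as `le_finrank_of_pencilCheck`). [folklore] -/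
theorem le_finrank_of_pencilCheckK (n K P r : ℕ) (hK : K ≤ n + 1) (hK0 : 0 < K) [NeZero P]
    (h : pencilCheckK n K P r hK hK0 = true) :
    r ≤ Module.finrank ℂ ↥(Submodule.span ℂ (Set.range fun tc : Fin 4 × (Fin (n + 1) × Fin (n + 1)) =>
      (X tc.1 : MvPolynomial (Fin 4) ℂ) *
        aeval (fun ij : Fin (n + 1) × Fin (n + 1) =>
          ∑ t : Fin 4, (fun ij t => ((pencilZ n ij t : ℤ) : ℂ)) ij t • (X t : MvPolynomial (Fin 4) ℂ))
          (pderiv tc.2 (perPoly (Fin (n + 1)) ℂ)))) := by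
  set sol := solveCert (valTableK n K hK P) (4 * (K * (n + 1))) P r with hsol
  have hEN := mulCheckN_sound r _ _ h
  have hE : (EfastK n K P r hK0 (valTableK n K hK P) sol).map (Nat.cast : ℕ → ZMod certP) =
      Matrix.of fun a b : Fin r => valP n (fun t => pointZ (selPoint P sol a) t)
        (toFullMember n K hK ((memberEquivK n K).symm (selCodeK n K hK0 sol b))) := by
    ext a b
    rw [Matrix.map_apply, natCast_EfastK_apply, Matrix.of_apply]
  rw [hE] at hEN
  exact le_finrank_of_valP_mul_eq_one n r _ _ _ hEN

end Summit.ValiantsHypothesis.ValiantsHypothesis.Theorems.ValuativeFlip
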